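import Mathlib
import Literature.NumberTheory.Transcendental.SemialgebraicMapsProofs
import Literature.NumberTheory.Transcendental.SemialgebraicVolume
import Literature.ModelTheory.ExponentialFields.SemialgebraicInterior
import Summits.KontsevichZagierPeriods.KontsevichZagierPeriods.Theorems.SymplecticScissorsPlanarSAZylevEquidec

/-!
# Crux `SymplecticScissors.PlanarSAZylev` (stmt-KontsevichZagierPeriods-9848), line `reservoir-peeling`:
Zylev–Sah cancellation in the measured refinement monoid of bounded `ℚ`-regions

`assembly_smallSummandsCancel` / `assembly_cancel_of_measuredRefinement`: the abstract lever (an additive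
commutative monoid with a faithful non-negative additive valuation, binary Riesz refinement, strict
comparability and small subdivision is cancellative; Boltianskii 1978 §16, copied from the crux's idea
sketch).  `assembly_planarCancel` (= stub `stub_planarCancel`): the planar instance, for a monoid
presented as bounded `ℚ`-semialgebraic sets modulo the pinned equivalence `E` by a map `mk`; area is
the valuation, refinement the 2 × 2 refinement of `stub_teCalc` after separating summands by rational
translations, comparability the mosaic lemma, subdivision thin vertical rational strips.  No definitions.
-/

noncomputable section

open MeasureTheory Set
open Literature.NumberTheory.Transcendental Literature.ModelTheory.ExponentialFields

namespace Summit.KontsevichZagierPeriods.SymplecticScissors.PlanarSAZylev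

/-! ### The abstract lever -/

/-- **Small summands cancel.** In an additive commutative monoid with a non-negative additive
`v`, the binary refinement property and the strict embedding property (`v b < v a → b + d = a`),
`x + p = y + p` with `2·v p < v x` forces `x = y` (Zylev's exchange, Boltianskii 1978 §16
Lemma 13 at `k = 1`). [cite: Boltianskii1978, §16 Lemma 13] -/
theorem assembly_smallSummandsCancel {M : Type*} [AddCommMonoid M] (v : M →+ ℝ)
    (hv0 : ∀ a, 0 ≤ v a)
    (href : ∀ a₁ a₂ b₁ b₂ : M, a₁ + a₂ = b₁ + b₂ →
      ∃ c₁₁ c₁₂ c₂₁ c₂₂ : M, a₁ = c₁₁ + c₁₂ ∧ a₂ = c₂₁ + c₂₂ ∧ b₁ = c₁₁ + c₂₁ ∧ b₂ = c₁₂ + c₂₂)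
    (hemb : ∀ a b : M, v b < v a → ∃ d, b + d = a)
    {x y p : M} (h : x + p = y + p) (hp : 2 * v p < v x) : x = y := by
  -- adapted from Cruxes/PlanarSAZylev/SketchIdeator3.lean (idea measured-refinement-monoid-zylev)
  obtain ⟨c₁₁, c₁₂, c₂₁, c₂₂, hx, hpL, hy, hpR⟩ := href x p y p h
  have e1 := congrArg v hpL; have e2 := congrArg v hpR; have e3 := congrArg v hx
  rw [map_add] at e1 e2 e3
  obtain ⟨n, hn⟩ := hemb c₁₁ c₂₂ (by linarith [hv0 c₂₁, hv0 c₂₂])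
  calc x = c₁₁ + c₁₂ := hx
    _ = (c₂₂ + n) + c₁₂ := by rw [hn]
    _ = n + (c₁₂ + c₂₂) := by abel
    _ = n + p := by rw [← hpR]
    _ = n + (c₂₁ + c₂₂) := by rw [← hpL]
    _ = (c₂₂ + n) + c₂₁ := by abel
    _ = c₁₁ + c₂₁ := by rw [hn]
    _ = y := hy.symm

/-- **Abstract Zylev–Sah: measured refinement monoids are cancellative.** Add faithfulness
(`v a = 0 → a = 0`) and divisibility (every element is a finite sum of elements of `v`-size `< ε`):
then `a + c = b + c → a = b` — cut `c` into pieces of size `< v a / 2` and peel them one at a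
time with `assembly_smallSummandsCancel`. [cite: Boltianskii1978, §16 Thm 22] -/
theorem assembly_cancel_of_measuredRefinement {M : Type*} [AddCommMonoid M] (v : M →+ ℝ)
    (hv0 : ∀ a, 0 ≤ v a) (hfaith : ∀ a, v a = 0 → a = 0)
    (href : ∀ a₁ a₂ b₁ b₂ : M, a₁ + a₂ = b₁ + b₂ →
      ∃ c₁₁ c₁₂ c₂₁ c₂₂ : M, a₁ = c₁₁ + c₁₂ ∧ a₂ = c₂₁ + c₂₂ ∧ b₁ = c₁₁ + c₂₁ ∧ b₂ = c₁₂ + c₂₂)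
    (hemb : ∀ a b : M, v b < v a → ∃ d, b + d = a)
    (hdiv : ∀ (c : M) (ε : ℝ), 0 < ε → ∃ l : List M, l.sum = c ∧ ∀ p ∈ l, v p < ε)
    (a b c : M) (h : a + c = b + c) : a = b := by
  -- adapted from Cruxes/PlanarSAZylev/SketchIdeator3.lean (idea measured-refinement-monoid-zylev)
  by_cases ha : v a = 0
  · have hb : v b = 0 := by
      have := congrArg v h; rw [map_add, map_add] at this; linarith
    rw [hfaith a ha, hfaith b hb]
  · have hapos : 0 < v a := lt_of_le_of_ne (hv0 a) (Ne.symm ha)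
    obtain ⟨l, rfl, hl⟩ := hdiv c (v a / 2) (by linarith)
    suffices H : ∀ l : List M, (∀ p ∈ l, v p < v a / 2) → a + l.sum = b + l.sum → a = b from
      H l hl h
    intro l
    induction l with
    | nil => intro _ h; simpa using h
    | cons p l ih =>
      intro hl h
      apply ih (fun q hq => hl q (List.mem_cons_of_mem p hq))
      have hp : v p < v a / 2 := hl p (by simp)
      have hsum : 0 ≤ v l.sum := by
        rw [map_list_sum]
        exact List.sum_nonneg (fun x hx => by
          obtain ⟨q, -, rfl⟩ := List.mem_map.mp hx
          exact hv0 q)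
      have hx : 2 * v p < v (a + l.sum) := by rw [map_add]; linarith
      refine assembly_smallSummandsCancel v hv0 href hemb ?_ hx
      simp only [List.sum_cons] at h
      calc a + l.sum + p = a + (p + l.sum) := by abel
        _ = b + (p + l.sum) := h
        _ = b + l.sum + p := by abel

/-! ### The planar instance -/
/-- Volume of a thin vertical strip of the box `[-N, N]²`: the part of `{x | |x₁| ≤ N}` between the
abscissae `s` and `s + w` (`w ≥ 0`) has area at most `w · (2N)` — it lies in the box
`[s, s + w] × [-N, N]` (for `w < 0` both sides vanish). [folklore] -/
theorem assembly_volume_strip_le (N : ℕ) (s w : ℝ) :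
    volume {x : Fin 2 → ℝ | s ≤ x 0 ∧ x 0 < s + w ∧ |x 1| ≤ N} ≤
      ENNReal.ofReal w * ENNReal.ofReal (2 * N) := by
  have hsub : {x : Fin 2 → ℝ | s ≤ x 0 ∧ x 0 < s + w ∧ |x 1| ≤ N} ⊆
      Set.pi univ (fun i : Fin 2 => if i = 0 then Icc s (s + w) else Icc (-(N : ℝ)) N) := by
    intro x hx i _
    fin_cases i
    · simp only [Fin.zero_eta, Fin.isValue, ↓reduceIte, mem_Icc]
      exact ⟨hx.1, hx.2.1.le⟩
    · simp only [Fin.mk_one, Fin.isValue, one_ne_zero, ↓reduceIte, mem_Icc]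
      exact abs_le.1 hx.2.2
  refine (measure_mono hsub).trans ?_
  rw [volume_pi_pi]
  simp only [Fin.prod_univ_two, Fin.isValue, ↓reduceIte, one_ne_zero, Real.volume_Icc]
  apply le_of_eq
  congr 1
  · rw [add_sub_cancel_left]
  · congr 1; ring

/-- **The planar measured refinement monoid is cancellative**: a monoid presented by `mk` as
bounded `ℚ`-regions modulo the pinned `E` (symmetric, area-preserving, with 2 × 2 refinement and the
mosaic lemma) is a measured refinement monoid for area, hence cancellative.
[cite: Boltianskii1978, §16 Thm 22] -/
theorem assembly_planarCancel (E : Set (Fin 2 → ℝ) → Set (Fin 2 → ℝ) → Prop)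
    (HE : ∀ A B : Set (Fin 2 → ℝ), E A B ↔
        ∃ (U : Set (Fin 2 → ℝ)) (Φ : (Fin 2 → ℝ) → (Fin 2 → ℝ)),
          U ⊆ A ∧ IsSemialgebraic ℚ U ∧ IsOpen U ∧ volume (A \ U) = 0 ∧
          IsSemialgebraicMapOn ℚ U Φ ∧ ContDiffOn ℝ 1 Φ U ∧ InjOn Φ U ∧
          (∀ p ∈ U, |(fderiv ℝ Φ p).det| = 1) ∧ Φ '' U ⊆ B ∧ volume (B \ Φ '' U) = 0)
    (hsymm : ∀ A B : Set (Fin 2 → ℝ), E A B → E B A)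
    (hvol : ∀ A B : Set (Fin 2 → ℝ), E A B → volume A = volume B)
    (hrefine : ∀ (A B : Fin 2 → Set (Fin 2 → ℝ)), (∀ i, IsSemialgebraic ℚ (A i)) →
      (∀ j, IsSemialgebraic ℚ (B j)) → Disjoint (A 0) (A 1) → Disjoint (B 0) (B 1) →
      E (A 0 ∪ A 1) (B 0 ∪ B 1) →
      ∃ C D : Fin 2 → Fin 2 → Set (Fin 2 → ℝ),
        (∀ i j, IsSemialgebraic ℚ (C i j) ∧ IsSemialgebraic ℚ (D i j) ∧ C i j ⊆ A i ∧
          D i j ⊆ B j ∧ E (C i j) (D i j)) ∧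
        (∀ i, Disjoint (C i 0) (C i 1) ∧ volume (A i \ (C i 0 ∪ C i 1)) = 0) ∧
        (∀ j, Disjoint (D 0 j) (D 1 j) ∧ volume (B j \ (D 0 j ∪ D 1 j)) = 0))
    (hmosaic : ∀ A B : Set (Fin 2 → ℝ), IsSemialgebraic ℚ A → IsSemialgebraic ℚ B →
      Bornology.IsBounded A → Bornology.IsBounded B → volume B < volume A →
      ∃ W : Set (Fin 2 → ℝ), W ⊆ A ∧ IsSemialgebraic ℚ W ∧ E B W)
    {M : Type*} [AddCommMonoid M]
    (mk : {A : Set (Fin 2 → ℝ) // IsSemialgebraic ℚ A ∧ Bornology.IsBounded A} → M)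
    (hmk_eq : ∀ A B : {A : Set (Fin 2 → ℝ) // IsSemialgebraic ℚ A ∧ Bornology.IsBounded A},
      mk A = mk B ↔ E A.1 B.1)
    (hmk_add : ∀ A B : {A : Set (Fin 2 → ℝ) // IsSemialgebraic ℚ A ∧ Bornology.IsBounded A},
      Disjoint A.1 B.1 → mk A + mk B = mk ⟨A.1 ∪ B.1, A.2.1.union B.2.1, A.2.2.union B.2.2⟩)
    (hmk_zero : mk ⟨∅, isSemialgebraic_empty, Bornology.isBounded_empty⟩ = 0)
    (hmk_surj : Function.Surjective mk) :
    ∀ a b c : M, a + c = b + c → a = b := by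
  classical
  have hfin : ∀ A : {A : Set (Fin 2 → ℝ) // IsSemialgebraic ℚ A ∧ Bornology.IsBounded A},
      volume A.1 ≠ ⊤ := fun A => A.2.2.measure_lt_top.ne
  -- co-null semialgebraic subsets have the same class
  have hsubclass : ∀ (A : {A : Set (Fin 2 → ℝ) // IsSemialgebraic ℚ A ∧ Bornology.IsBounded A})
      (A' : Set (Fin 2 → ℝ)) (hA'sa : IsSemialgebraic ℚ A') (hsub : A' ⊆ A.1)
      (hnull : volume (A.1 \ A') = 0), mk A = mk ⟨A', hA'sa, A.2.2.subset hsub⟩ :=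
    fun A A' hA'sa hsub hnull => (hmk_eq _ _).2 (assembly_subConull E HE hsub hA'sa hnull).1
  -- separating a bounded set from another one by a rational translation keeps the class
  have hshift : ∀ A B : {A : Set (Fin 2 → ℝ) // IsSemialgebraic ℚ A ∧ Bornology.IsBounded A},
      ∃ B' : {A : Set (Fin 2 → ℝ) // IsSemialgebraic ℚ A ∧ Bornology.IsBounded A},
        mk B = mk B' ∧ Disjoint A.1 B'.1 ∧ volume B'.1 = volume B.1 := by
    intro A B
    obtain ⟨q, hq⟩ := assembly_exists_shift A.2.2 B.2.2
    have hvq : ∀ i, (fun i => (q i : ℝ)) i = q i := fun i => rfl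
    have hbd : Bornology.IsBounded ((fun x => x + fun i => (q i : ℝ)) '' B.1) := by
      rw [← Set.add_singleton]; exact B.2.2.add Bornology.isBounded_singleton
    exact ⟨⟨_, mosaic_isSemialgebraic_translate B.2.1 _ q hvq, hbd⟩,
      (hmk_eq _ _).2 (mosaic_translate E HE B.2.1 _ q hvq), hq, mosaic_volume_translate _ B.1⟩
  -- the valuation
  let v₀ : M → ℝ := fun x => (volume (Classical.choose (hmk_surj x)).1).toReal
  have hv₀ : ∀ A, v₀ (mk A) = (volume A.1).toReal := fun A => by
    show (volume _).toReal = _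
    rw [hvol _ _ ((hmk_eq _ A).1 (Classical.choose_spec (hmk_surj (mk A))))]
  have hv₀add : ∀ x y, v₀ (x + y) = v₀ x + v₀ y := by
    intro x y
    obtain ⟨A, rfl⟩ := hmk_surj x
    obtain ⟨B, rfl⟩ := hmk_surj y
    obtain ⟨B', hBB', hdisj, hvolB'⟩ := hshift A B
    rw [hBB', hmk_add A B' hdisj, hv₀, hv₀, hv₀]
    show (volume (A.1 ∪ B'.1)).toReal = _
    rw [measure_union hdisj (IsSemialgebraic.measurableSet_holds B'.2.1), hvolB',
      ENNReal.toReal_add (hfin A) (hfin B)]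
  let w : M →+ ℝ :=
    { toFun := v₀
      map_zero' := by
        show v₀ 0 = 0
        rw [← hmk_zero, hv₀]
        simp
      map_add' := hv₀add }
  have hw : ∀ A, w (mk A) = (volume A.1).toReal := hv₀
  -- the axioms of a measured refinement monoid
  have hw0 : ∀ x, 0 ≤ w x := fun x => by
    obtain ⟨A, rfl⟩ := hmk_surj x; rw [hw]; exact ENNReal.toReal_nonneg
  have hfaith : ∀ x, w x = 0 → x = 0 := by
    intro x hx
    obtain ⟨A, rfl⟩ := hmk_surj x
    rw [hw, ENNReal.toReal_eq_zero_iff] at hx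
    have hA0 : volume A.1 = 0 := hx.resolve_right (hfin A)
    rw [← hmk_zero, hmk_eq]
    exact assembly_null E HE hA0 measure_empty
  have href' : ∀ a₁ a₂ b₁ b₂ : M, a₁ + a₂ = b₁ + b₂ →
      ∃ c₁₁ c₁₂ c₂₁ c₂₂ : M, a₁ = c₁₁ + c₁₂ ∧ a₂ = c₂₁ + c₂₂ ∧ b₁ = c₁₁ + c₂₁ ∧
        b₂ = c₁₂ + c₂₂ := by
    intro a₁ a₂ b₁ b₂ h
    obtain ⟨A₁, rfl⟩ := hmk_surj a₁
    obtain ⟨A₂, rfl⟩ := hmk_surj a₂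
    obtain ⟨B₁, rfl⟩ := hmk_surj b₁
    obtain ⟨B₂, rfl⟩ := hmk_surj b₂
    obtain ⟨A₂', hA₂, hdA, -⟩ := hshift A₁ A₂
    obtain ⟨B₂', hB₂, hdB, -⟩ := hshift B₁ B₂
    rw [hA₂, hB₂, hmk_add A₁ A₂' hdA, hmk_add B₁ B₂' hdB, hmk_eq] at h
    obtain ⟨C, D, hCD, hCi, hDj⟩ := hrefine ![A₁.1, A₂'.1] ![B₁.1, B₂'.1]
      (fun i => by fin_cases i <;> simp [A₁.2.1, A₂'.2.1])
      (fun j => by fin_cases j <;> simp [B₁.2.1, B₂'.2.1]) hdA hdB h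
    have hCb : ∀ i j, Bornology.IsBounded (C i j) := fun i j => by
      fin_cases i
      · exact A₁.2.2.subset (by simpa using (hCD 0 j).2.2.1)
      · exact A₂'.2.2.subset (by simpa using (hCD 1 j).2.2.1)
    let c : Fin 2 → Fin 2 → M := fun i j => mk ⟨C i j, (hCD i j).1, hCb i j⟩
    have hDclass : ∀ i j, mk ⟨D i j, (hCD i j).2.1,
        by fin_cases j
           · exact B₁.2.2.subset (by simpa using (hCD i 0).2.2.2.1)
           · exact B₂'.2.2.subset (by simpa using (hCD i 1).2.2.2.1)⟩ = c i j :=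
      fun i j => ((hmk_eq _ _).2 (hsymm _ _ (hCD i j).2.2.2.2))
    have hrow : ∀ (i : Fin 2) (X : {A : Set (Fin 2 → ℝ) // IsSemialgebraic ℚ A ∧
        Bornology.IsBounded A}), X.1 = (![A₁.1, A₂'.1] : Fin 2 → Set (Fin 2 → ℝ)) i →
        mk X = c i 0 + c i 1 := by
      intro i X hX
      have hsub : C i 0 ∪ C i 1 ⊆ X.1 := by
        rw [hX]; exact union_subset (hCD i 0).2.2.1 (hCD i 1).2.2.1
      rw [hsubclass X (C i 0 ∪ C i 1) ((hCD i 0).1.union (hCD i 1).1) hsub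
        (by rw [hX]; exact (hCi i).2)]
      show mk _ = mk ⟨C i 0, (hCD i 0).1, hCb i 0⟩ + mk ⟨C i 1, (hCD i 1).1, hCb i 1⟩
      rw [hmk_add _ _ (hCi i).1]
    have hcol : ∀ (j : Fin 2) (X : {A : Set (Fin 2 → ℝ) // IsSemialgebraic ℚ A ∧
        Bornology.IsBounded A}), X.1 = (![B₁.1, B₂'.1] : Fin 2 → Set (Fin 2 → ℝ)) j →
        mk X = c 0 j + c 1 j := by
      intro j X hX
      have hsub : D 0 j ∪ D 1 j ⊆ X.1 := by
        rw [hX]; exact union_subset (hCD 0 j).2.2.2.1 (hCD 1 j).2.2.2.1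
      rw [hsubclass X (D 0 j ∪ D 1 j) ((hCD 0 j).2.1.union (hCD 1 j).2.1) hsub
        (by rw [hX]; exact (hDj j).2), ← hDclass 0 j, ← hDclass 1 j, hmk_add _ _ (hDj j).1]
    refine ⟨c 0 0, c 0 1, c 1 0, c 1 1, hrow 0 A₁ rfl, ?_, hcol 0 B₁ rfl, ?_⟩
    · rw [hA₂]; exact hrow 1 A₂' rfl
    · rw [hB₂]; exact hcol 1 B₂' rfl
  have hemb : ∀ a b : M, w b < w a → ∃ d, b + d = a := by
    intro a b hab
    obtain ⟨A, rfl⟩ := hmk_surj a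
    obtain ⟨B, rfl⟩ := hmk_surj b
    rw [hw, hw] at hab
    have hlt : volume B.1 < volume A.1 := (ENNReal.toReal_lt_toReal (hfin B) (hfin A)).1 hab
    obtain ⟨W, hWA, hWsa, hBW⟩ := hmosaic A.1 B.1 A.2.1 B.2.1 A.2.2 B.2.2 hlt
    have hWb : Bornology.IsBounded W := A.2.2.subset hWA
    refine ⟨mk ⟨A.1 \ W, A.2.1.diff hWsa, A.2.2.subset sdiff_subset⟩, ?_⟩
    rw [(hmk_eq B ⟨W, hWsa, hWb⟩).2 hBW, hmk_add ⟨W, hWsa, hWb⟩ _ disjoint_sdiff_right]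
    have : W ∪ (A.1 \ W) = A.1 := union_sdiff_cancel hWA
    exact (hsubclass A _ (hWsa.union (A.2.1.diff hWsa)) this.subset (by rw [this]; simp)).symm
  have hdiv : ∀ (x : M) (ε : ℝ), 0 < ε → ∃ l : List M, l.sum = x ∧ ∀ p ∈ l, w p < ε := by
    intro x ε hε
    obtain ⟨A, rfl⟩ := hmk_surj x
    obtain ⟨N, hN⟩ := mosaic_exists_bound A.2.2
    -- number of strips per unit length
    obtain ⟨n, hn⟩ := exists_nat_gt (2 * (N : ℝ) / ε)
    have hn0 : 0 < n := by
      have : (0 : ℝ) ≤ 2 * N / ε := by positivity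
      exact_mod_cast this.trans_lt hn
    have hnR : (0 : ℝ) < n := by exact_mod_cast hn0
    -- the strips `k ≤ n (x₀ + N) < k + 1`, `k ≤ 2 N n`
    let P : ℕ → Set (Fin 2 → ℝ) := fun k =>
      A.1 ∩ {x | (k : ℝ) ≤ n * (x 0 + N) ∧ n * (x 0 + N) < k + 1}
    have hPsa : ∀ k, IsSemialgebraic ℚ (P k) := by
      intro k
      refine A.2.1.inter ?_
      have h1 : IsSemialgebraic ℚ {x : Fin 2 → ℝ | (k : ℝ) ≤ n * (x 0 + N)} := by
        convert (isSemialgebraic_setOf_eval_pos (k := ℚ) (R := ℝ)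
          (MvPolynomial.C ((k : ℚ) - (n : ℚ) * N) -
            (n : MvPolynomial (Fin 2) ℚ) * MvPolynomial.X 0)).compl using 1
        ext x
        simp only [mem_setOf_eq, mem_compl_iff, map_sub, map_mul, map_natCast, MvPolynomial.aeval_X,
          sub_pos, not_lt]
        constructor
        · intro h; linarith
        · intro h; linarith
      have h2 : IsSemialgebraic ℚ {x : Fin 2 → ℝ | (n : ℝ) * (x 0 + N) < k + 1} := by
        convert isSemialgebraic_setOf_eval_pos (k := ℚ) (R := ℝ)
          (MvPolynomial.C ((k : ℚ) + 1 - (n : ℚ) * N) -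
            (n : MvPolynomial (Fin 2) ℚ) * MvPolynomial.X 0) using 1
        ext x
        simp only [mem_setOf_eq, map_sub, map_mul, map_natCast, MvPolynomial.aeval_X,
          MvPolynomial.aeval_C, eq_ratCast, Rat.cast_add, Rat.cast_natCast, Rat.cast_one, sub_pos]
        constructor
        · intro h; linarith
        · intro h; linarith
      simpa only [setOf_and] using h1.inter h2
    have hPb : ∀ k, Bornology.IsBounded (P k) := fun k => A.2.2.subset inter_subset_left
    have hPsmall : ∀ k, w (mk ⟨P k, hPsa k, hPb k⟩) < ε := by
      intro k
      rw [hw]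
      have hle : volume (P k) ≤ ENNReal.ofReal (1 / n) * ENNReal.ofReal (2 * N) := by
        refine le_trans (measure_mono ?_) (assembly_volume_strip_le N ((k : ℝ) / n - N) (1 / n))
        intro x hx
        refine ⟨?_, ?_, hN x hx.1 1⟩
        · have : (k : ℝ) / n ≤ x 0 + N := by rw [div_le_iff₀ hnR]; linarith [hx.2.1]
          linarith
        · have : x 0 + N < ((k : ℝ) + 1) / n := by rw [lt_div_iff₀ hnR]; linarith [hx.2.2]
          have e : ((k : ℝ) + 1) / n = k / n + 1 / n := by rw [add_div]
          linarith
      have hlt : ENNReal.ofReal (1 / n) * ENNReal.ofReal (2 * N) < ENNReal.ofReal ε := by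
        rw [← ENNReal.ofReal_mul (by positivity), ENNReal.ofReal_lt_ofReal_iff hε]
        rw [div_lt_iff₀ hε] at hn
        rw [one_div, inv_mul_lt_iff₀ hnR]
        linarith
      have := hle.trans_lt hlt
      exact ((ENNReal.toReal_lt_toReal (this.trans ENNReal.ofReal_lt_top).ne
        ENNReal.ofReal_ne_top).2 this).trans_eq (ENNReal.toReal_ofReal hε.le)
    -- disjointness of the strips
    have hPdisj : ∀ k k', k ≠ k' → Disjoint (P k) (P k') := by
      intro k k' hkk'
      wlog hlt : k < k' generalizing k k'
      · exact (this k' k hkk'.symm (lt_of_le_of_ne (not_lt.1 hlt) hkk'.symm)).symm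
      refine Set.disjoint_left.2 fun x hx hx' => ?_
      have h1 := hx.2.2
      have h2 := hx'.2.1
      have : (k : ℝ) + 1 ≤ k' := by exact_mod_cast Nat.succ_le_of_lt hlt
      linarith
    -- finite unions of the strips
    have hUnion : ∀ j : ℕ, ((List.range j).map fun k => mk ⟨P k, hPsa k, hPb k⟩).sum =
        mk ⟨⋃ k ∈ Finset.range j, P k, IsSemialgebraic.biUnion _ _ fun k _ => hPsa k,
          A.2.2.subset (iUnion₂_subset fun k _ => inter_subset_left)⟩ := by
      intro j
      induction j with
      | zero =>
        rw [List.range_zero, List.map_nil, List.sum_nil, ← hmk_zero]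
        congr 1
        exact Subtype.ext (by simp)
      | succ j ih =>
        have hd : Disjoint (⋃ k ∈ Finset.range j, P k) (P j) :=
          disjoint_iUnion₂_left.2 fun k hk => hPdisj k j (Finset.mem_range.1 hk).ne
        rw [List.range_succ, List.map_append, List.sum_append, ih, List.map_singleton,
          List.sum_singleton, hmk_add _ _ hd]
        congr 1
        refine Subtype.ext ?_
        show (⋃ k ∈ Finset.range j, P k) ∪ P j = ⋃ k ∈ Finset.range (j + 1), P k
        rw [Finset.range_add_one, Finset.set_biUnion_insert, union_comm]
    refine ⟨(List.range (2 * N * n + 1)).map fun k => mk ⟨P k, hPsa k, hPb k⟩, ?_, ?_⟩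
    · rw [hUnion]
      refine (hsubclass A _ (IsSemialgebraic.biUnion _ _ fun k _ => hPsa k)
        (iUnion₂_subset fun k _ => inter_subset_left) ?_).symm
      -- the strips cover `A`
      have hcov : A.1 ⊆ ⋃ k ∈ Finset.range (2 * N * n + 1), P k := by
        intro x hx
        have hx0 := abs_le.1 (hN x hx 0)
        set k : ℕ := ⌊(n : ℝ) * (x 0 + N)⌋₊ with hk
        have hxN : 0 ≤ (n : ℝ) * (x 0 + N) := by nlinarith [hx0.1]
        have hk1 : (k : ℝ) ≤ n * (x 0 + N) := Nat.floor_le hxN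
        have hk2 : (n : ℝ) * (x 0 + N) < k + 1 := Nat.lt_floor_add_one _
        have hkle : (k : ℝ) ≤ 2 * N * n := hk1.trans (by nlinarith [hx0.2])
        exact mem_iUnion₂.2 ⟨k, Finset.mem_range.2 (Nat.lt_succ_of_le (by exact_mod_cast hkle)),
          hx, hk1, hk2⟩
      rw [sdiff_eq_empty.2 hcov]
      exact measure_empty
    · intro p hp
      obtain ⟨k, -, rfl⟩ := List.mem_map.1 hp
      exact hPsmall k
  exact assembly_cancel_of_measuredRefinement w hw0 hfaith href' hemb hdiv

/-- **The planar measured refinement monoid is cancellative** (stub `stub_planarCancel` of the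
line, the lead's reshaping of its assembly stub; = `assembly_planarCancel` as a closed statement).
[cite: Boltianskii1978, §16 Thm 22] -/
theorem stub_planarCancel :
    ∀ (E : Set (Fin 2 → ℝ) → Set (Fin 2 → ℝ) → Prop),
      (∀ A B : Set (Fin 2 → ℝ), E A B ↔
        ∃ (U : Set (Fin 2 → ℝ)) (Φ : (Fin 2 → ℝ) → (Fin 2 → ℝ)),
          U ⊆ A ∧ IsSemialgebraic ℚ U ∧ IsOpen U ∧ volume (A \ U) = 0 ∧
          IsSemialgebraicMapOn ℚ U Φ ∧ ContDiffOn ℝ 1 Φ U ∧ InjOn Φ U ∧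
          (∀ p ∈ U, |(fderiv ℝ Φ p).det| = 1) ∧ Φ '' U ⊆ B ∧ volume (B \ Φ '' U) = 0) →
    (∀ A B : Set (Fin 2 → ℝ), E A B → E B A) →
    (∀ A B : Set (Fin 2 → ℝ), E A B → volume A = volume B) →
    (∀ (A B : Fin 2 → Set (Fin 2 → ℝ)), (∀ i, IsSemialgebraic ℚ (A i)) →
      (∀ j, IsSemialgebraic ℚ (B j)) → Disjoint (A 0) (A 1) → Disjoint (B 0) (B 1) →
      E (A 0 ∪ A 1) (B 0 ∪ B 1) →
      ∃ C D : Fin 2 → Fin 2 → Set (Fin 2 → ℝ),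
        (∀ i j, IsSemialgebraic ℚ (C i j) ∧ IsSemialgebraic ℚ (D i j) ∧ C i j ⊆ A i ∧
          D i j ⊆ B j ∧ E (C i j) (D i j)) ∧
        (∀ i, Disjoint (C i 0) (C i 1) ∧ volume (A i \ (C i 0 ∪ C i 1)) = 0) ∧
        (∀ j, Disjoint (D 0 j) (D 1 j) ∧ volume (B j \ (D 0 j ∪ D 1 j)) = 0)) →
    (∀ A B : Set (Fin 2 → ℝ), IsSemialgebraic ℚ A → IsSemialgebraic ℚ B →
      Bornology.IsBounded A → Bornology.IsBounded B → volume B < volume A →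
      ∃ W : Set (Fin 2 → ℝ), W ⊆ A ∧ IsSemialgebraic ℚ W ∧ E B W) →
    ∀ (M : Type) [AddCommMonoid M]
      (mk : {A : Set (Fin 2 → ℝ) // IsSemialgebraic ℚ A ∧ Bornology.IsBounded A} → M),
      (∀ A B : {A : Set (Fin 2 → ℝ) // IsSemialgebraic ℚ A ∧ Bornology.IsBounded A},
        mk A = mk B ↔ E A.1 B.1) →
      (∀ A B : {A : Set (Fin 2 → ℝ) // IsSemialgebraic ℚ A ∧ Bornology.IsBounded A},
        Disjoint A.1 B.1 → mk A + mk B = mk ⟨A.1 ∪ B.1, A.2.1.union B.2.1, A.2.2.union B.2.2⟩) →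
      mk ⟨∅, isSemialgebraic_empty, Bornology.isBounded_empty⟩ = 0 →
      Function.Surjective mk →
      ∀ a b c : M, a + c = b + c → a = b := by
  intro E HE hsymm hvol hrefine hmosaic M _ mk hmk_eq hmk_add hmk_zero hmk_surj
  exact assembly_planarCancel E HE hsymm hvol hrefine hmosaic mk hmk_eq hmk_add hmk_zero hmk_surj

end Summit.KontsevichZagierPeriods.SymplecticScissors.PlanarSAZylev
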